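import Literature.AlgebraicGeometry.Motives.CurveDivisorsFunctionField
import Literature.AlgebraicGeometry.Motives.CyclesDimensionFunctionField
import Literature.AlgebraicGeometry.Motives.PushforwardStructureSheaf
import Literature.AlgebraicGeometry.Motives.FunctionFieldOver
import Literature.NumberTheory.DiophantineGeometry.FunctionFieldAdelesProofs
import Literature.AlgebraicGeometry.Motives.VarietiesDimensionProofs
import HarnessLib

/-!
# Riemann–Roch for Cartier divisors on a smooth complete curve (Hartshorne IV.1 Thm. 1.3)

For a smooth proper curve `C / K` (integral `K`-scheme smooth of relative dimension one, proper),
with function field `K(C)` and the dictionary of `Motives/CurvePlaces`,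
`Motives/CurveDivisorsFunctionField` (`h⁰(C, 𝒪(D)) = ℓ(toDivisor D)`, `deg (toDivisor D) = deg_K D`),
this file transports the Riemann–Roch theorem of the tree's function-field library
(`NumberTheory/DiophantineGeometry/FunctionFieldAdelesProofs`: `riemann_roch_holds`,
`ell_eq_of_lt_degree_holds`; `FunctionFieldGenusRiemannTheoremProofs`:
`degree_add_one_sub_ell_le_genus_holds`) to Cartier divisors on `C`:

* `height_top_of_smoothCurve` — `dim C = 1` (`height ⊤ = 1` in the specialisation order);
* `isAlgFunctionField`, `isAlgFunctionField_of_smoothCurve` — **`K(C)/K` is an algebraic function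
  field of one variable** (`trdeg_K K(C) = dim C = 1`, Görtz–Wedhorn I Thm. 5.22 (3), the tree's
  `height_top_eq_trdeg`; `K(C)` is generated by the coordinate ring of an affine chart);
* `isIntegrallyClosedIn`, `isIntegrallyClosedIn_of_smoothCurve` — **`K` is the full constant field
  of `K(C)`** when `C` is geometrically integral: an element algebraic over `K` is regular at every
  point (valuation rings are integrally closed), hence a global section (`RatFn.regularOn_eq_range`),
  and `Γ(C, 𝒪_C) = K` (`isIso_appTop_of_geometricallyIntegral`, Görtz–Wedhorn II Cor. 24.63);
* `curveGenus C := genus K K(C)` and **Riemann–Roch**: `degree_add_one_sub_genus_le_h0`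
  (`h⁰(D) ≥ deg D + 1 − g`), `h0_eq_of_lt_degree` (`h⁰(D) = deg D + 1 − g` for `deg D > 2g − 2`),
  `riemannRoch` (`h⁰(D) = deg D + 1 − g + ℓ(W − D)` for a canonical divisor `W` of `K(C)/K`),
  `h0_zero` (`h⁰(𝒪_C) = 1`).

Everything is proved; no named facts (D-0026). Used for Milne, *Jacobian Varieties* §§4–5
(`h⁰` computations on `C` and `C_{K'}`) in the proof of `nonempty_jacobian_of_isSmoothProjective`.

Mathlib searched (pin): `Algebra.trdeg`, `IntermediateField.FG`, `IsFractionRing.div_surjective`,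
`AlgHom.map_adjoin`, `isIntegrallyClosedIn_iff`, `IsIntegrallyClosed.isIntegral_iff`,
`IsIntegral.tower_top`, `irreducibleSetEquivPoints`, `krullDim_eq_iSup_height` (all used); Mathlib
has no Riemann–Roch.

## References

* R. Hartshorne, *Algebraic Geometry*, GTM 52 (1977): II.6 Cor. 6.12, IV.1 Thm. 1.3, Ex. 1.3.4.
  [Hartshorne1977]
* H. Stichtenoth, *Algebraic Function Fields and Codes*, 2nd ed. (2009): Def. 1.4.15, Thm. 1.4.17,
  Thm. 1.5.15, Thm. 1.5.17, Cor. 1.4.12. [Stichtenoth2009]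
* U. Görtz, T. Wedhorn, *Algebraic Geometry I* (2nd ed., 2020), Thm. 5.22 (3), Lemma 6.26;
  *Algebraic Geometry II* (2023), Cor. 24.63. [GortzWedhorn2020] [GortzWedhorn2023]
-/

noncomputable section

open CategoryTheory AlgebraicGeometry IsLocalRing Order

universe u

namespace Literature.AlgebraicGeometry.Motives

namespace CurvePlaces

open RatFn Literature.NumberTheory.DiophantineGeometry
  Literature.NumberTheory.DiophantineGeometry.AlgFunctionField

variable {K : Type u} [Field K]

/-! ### `K(C)/K` is an algebraic function field of one variable -/

section FunctionField

variable (C : SchemeOver K) [IsIntegral C.left] [LocallyOfFiniteType C.hom]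

/-- **`trdeg_K K(C) = 1` for an integral one-dimensional `K`-scheme of finite type**
(`dim C = trdeg_K K(C)`, Görtz–Wedhorn I Thm. 5.22 (3), the tree's `height_top_eq_trdeg`).
[cite: GortzWedhorn2020, Thm. 5.22 (3)] -/
theorem trdeg_functionField_eq_one (hC : height (⊤ : ↥C.left) = 1) :
    Algebra.trdeg K C.left.functionField = 1 := by
  haveI : LocallyOfFiniteType (C.left ↘ Spec (.of K)) := ‹LocallyOfFiniteType C.hom›
  have h := height_top_eq_trdeg (C.left ↘ Spec (.of K))
  have hfin := trdeg_functionField_lt_aleph0 (C.left ↘ Spec (.of K))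
  rw [hC] at h
  have h1 : Cardinal.toNat (Algebra.trdeg K C.left.functionField) = 1 := by
    have h' : ((1 : ℕ∞) : WithBot ℕ∞) =
        ((Cardinal.toNat (Algebra.trdeg K C.left.functionField) : ℕ∞) : WithBot ℕ∞) := h
    have h'' : (1 : ℕ∞) = (Cardinal.toNat (Algebra.trdeg K C.left.functionField) : ℕ∞) :=
      WithBot.coe_injective h'
    exact_mod_cast h''.symm
  have h2 := (Cardinal.cast_toNat_of_lt_aleph0 hfin)
  rw [h1] at h2
  exact_mod_cast h2.symm

/-- **`K(C)` is finitely generated over `K`** (by the generators of the coordinate ring of any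
affine chart, whose fraction field is `K(C)`). [folklore] -/
theorem fg_top_functionField : (⊤ : IntermediateField K C.left.functionField).FG := by
  classical
  let f := C.left ↘ Spec (.of K)
  haveI : LocallyOfFiniteType f := ‹LocallyOfFiniteType C.hom›
  obtain ⟨_, ⟨U, hU, rfl⟩, hηU, -⟩ :=
    C.left.isBasis_affineOpens.exists_subset_of_mem_open (Set.mem_univ (⊤ : ↥C.left)) isOpen_univ
  have hU : IsAffineOpen U := hU
  haveI : Nonempty U := ⟨⟨⊤, hηU⟩⟩
  let ι : K →+* Γ(Spec (CommRingCat.of K), ⊤) := (Scheme.ΓSpecIso (CommRingCat.of K)).inv.hom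
  let φU : K →+* Γ(C.left, U) := (f.appLE ⊤ U le_top).hom.comp ι
  letI algU : Algebra K Γ(C.left, U) := φU.toAlgebra
  haveI : Algebra.FiniteType K Γ(C.left, U) := by
    have h1 : (f.appLE ⊤ U le_top).hom.FiniteType :=
      f.finiteType_appLE (isAffineOpen_top _) hU le_top
    have h2 : ι.FiniteType :=
      RingHom.FiniteType.of_surjective _
        (Scheme.ΓSpecIso (CommRingCat.of K)).symm.commRingCatIsoToRingEquiv.surjective
    exact h1.comp h2
  haveI : IsFractionRing Γ(C.left, U) C.left.functionField :=
    functionField_isFractionRing_of_isAffineOpen C.left U hU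
  haveI : IsScalarTower K Γ(C.left, U) C.left.functionField := by
    refine IsScalarTower.of_algebraMap_eq fun c ↦ ?_
    change (C.left.presheaf.germ ⊤ (genericPoint C.left) trivial) (f.appTop (ι c)) =
      C.left.germToFunctionField U ((f.app ⊤ ≫ C.left.presheaf.map (homOfLE le_top).op) (ι c))
    have hres := TopCat.Presheaf.germ_res C.left.presheaf (homOfLE (le_top : U ≤ ⊤))
      (genericPoint C.left) hηU
    rw [Scheme.germToFunctionField, ← hres]
    rfl
  obtain ⟨s, hs⟩ := Algebra.FiniteType.out (R := K) (A := Γ(C.left, U))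
  refine ⟨s.image (algebraMap Γ(C.left, U) C.left.functionField), ?_⟩
  rw [eq_top_iff]
  rintro h -
  obtain ⟨a, b, -, rfl⟩ := IsFractionRing.div_surjective (A := Γ(C.left, U)) h
  have hmem : ∀ a : Γ(C.left, U), algebraMap Γ(C.left, U) C.left.functionField a ∈
      IntermediateField.adjoin K
        (↑(s.image (algebraMap Γ(C.left, U) C.left.functionField)) : Set C.left.functionField) := by
    intro a
    have ha : a ∈ Algebra.adjoin K (s : Set Γ(C.left, U)) := by rw [hs]; trivial
    have himg : (Algebra.adjoin K (s : Set Γ(C.left, U))).map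
        (IsScalarTower.toAlgHom K Γ(C.left, U) C.left.functionField) ≤
        (IntermediateField.adjoin K (↑(s.image (algebraMap Γ(C.left, U) C.left.functionField)) :
          Set C.left.functionField)).toSubalgebra := by
      rw [AlgHom.map_adjoin]
      refine (Algebra.adjoin_le ?_)
      intro y hy
      apply IntermediateField.subset_adjoin
      obtain ⟨z, hz, rfl⟩ := hy
      exact Finset.mem_coe.mpr (Finset.mem_image.mpr ⟨z, hz, rfl⟩)
    exact himg ⟨a, ha, rfl⟩
  exact div_mem (hmem a) (hmem b)

/-- **The function field of an integral one-dimensional `K`-scheme of finite type is an algebraic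
function field of one variable over `K`** (Hartshorne I.6 / II.6: "function field of dimension 1";
Stichtenoth Def. 1.1.1). [cite: Hartshorne1977, II.6 (curves and function fields, Cor. 6.12)] -/
theorem isAlgFunctionField (hC : height (⊤ : ↥C.left) = 1) : IsAlgFunctionField K C.left.functionField :=
  ⟨trdeg_functionField_eq_one C hC, fg_top_functionField C⟩

end FunctionField


/-! ### A smooth curve is one-dimensional -/

section Dimension

/-- The height of the generic point of an irreducible scheme is its topological Krull dimension
(same statement and proof as `Scheme.height_genericPoint` of `Motives/BettiCycleClassProofs`, whose
singular-homology import closure is not wanted here; kept private). [folklore] -/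
private theorem height_genericPoint_eq_topologicalKrullDim (Y : Scheme.{u}) [IrreducibleSpace Y] :
    (height (genericPoint Y) : WithBot ℕ∞) = topologicalKrullDim Y := by
  have hk : topologicalKrullDim Y = krullDim Y :=
    krullDim_eq_of_orderIso (irreducibleSetEquivPoints (α := Y))
  rw [hk]
  refine le_antisymm (height_le_krullDim _) ?_
  rw [krullDim_eq_iSup_height]
  exact iSup_le fun y ↦ WithBot.coe_le_coe.mpr
    (height_mono (Scheme.le_iff_specializes.mpr (genericPoint_specializes y)))

/-- **A smooth curve is one-dimensional**: `height ⊤ = 1` in the specialisation order of a nonempty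
`K`-scheme smooth of relative dimension one (Görtz–Wedhorn I Lemma 6.26; the tree's
`topologicalKrullDim_eq_of_smoothOfRelativeDimension`). [cite: GortzWedhorn2020, Lemma 6.26] -/
theorem height_top_of_smoothCurve (C : SchemeOver K) [IsIntegral C.left]
    [SmoothOfRelativeDimension 1 C.hom] : height (⊤ : ↥C.left) = 1 := by
  haveI : SmoothOfRelativeDimension 1 (C.left ↘ Spec (.of K)) := ‹SmoothOfRelativeDimension 1 C.hom›
  have h1 := height_genericPoint_eq_topologicalKrullDim C.left
  rw [topologicalKrullDim_eq_of_smoothOfRelativeDimension (C.left ↘ Spec (.of K)) (n := 1)] at h1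
  change (height (⊤ : ↥C.left) : WithBot ℕ∞) = (1 : ℕ) at h1
  exact_mod_cast h1

end Dimension

/-! ### `K` is the full constant field of `K(C)` for `C` geometrically integral -/

section Constants

variable (C : SchemeOver K) [IsIntegral C.left] [SmoothOfRelativeDimension 1 C.hom] [IsProper C.hom]

omit [IsProper C.hom] in
/-- On a smooth curve a rational function integral over `K` is regular everywhere (the local rings
are valuation rings, hence integrally closed). [folklore] -/
theorem isRegularAt_of_isIntegral {α : C.left.functionField} (hα : IsIntegral K α) (x : C.left) :
    IsRegularAt x α := by
  by_cases hx : x = genericPoint C.left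
  · subst hx; exact isRegularAt_genericPoint α
  haveI := isDiscreteValuationRing_stalk C hx
  have hint : IsIntegral (C.left.presheaf.stalk x) α := hα.tower_top
  exact (IsIntegrallyClosed.isIntegral_iff (R := C.left.presheaf.stalk x)
    (K := C.left.functionField)).mp hint

/-- **`K` is algebraically closed in `K(C)`** for a smooth proper geometrically integral curve `C`:
an element of `K(C)` algebraic over `K` is regular everywhere (`isRegularAt_of_isIntegral`), hence a
global section of `𝒪_C` (`RatFn.regularOn_eq_range`), and `Γ(C, 𝒪_C) = K`
(`isIso_appTop_of_geometricallyIntegral`, Görtz–Wedhorn II Cor. 24.63). So `K` is the full constant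
field of `K(C)/K` (Stichtenoth Def. 1.1.14 ff.). [cite: GortzWedhorn2023, Cor. 24.63 (p. 539)] -/
theorem isIntegrallyClosedIn [GeometricallyIntegral C.hom] :
    IsIntegrallyClosedIn K C.left.functionField := by
  refine isIntegrallyClosedIn_iff.mpr ⟨(algebraMap K C.left.functionField).injective, fun {α} hα ↦ ?_⟩
  have hreg : α ∈ regularOn (⊤ : C.left.Opens) := fun x _ ↦ isRegularAt_of_isIntegral C hα x
  rw [regularOn_eq_range (show genericPoint C.left ∈ (⊤ : C.left.Opens) from trivial)] at hreg
  obtain ⟨σ, hσ⟩ := hreg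
  haveI := isIso_appTop_of_geometricallyIntegral C.hom
  obtain ⟨c, hc⟩ := ((Scheme.ΓSpecIso (.of K)).symm ≪≫ asIso C.hom.appTop)
    |>.commRingCatIsoToRingEquiv.surjective σ
  refine ⟨c, ?_⟩
  rw [← hσ, ← hc]
  rfl

end Constants

/-! ### Riemann–Roch for `h⁰` of Cartier divisors on a smooth complete curve -/

section RiemannRoch

variable (C : SchemeOver K) [IsIntegral C.left] [SmoothOfRelativeDimension 1 C.hom] [IsProper C.hom]

omit [IsProper C.hom] in
/-- `K(C)/K` is an algebraic function field of one variable for a smooth curve `C / K`. [cite: Hartshorne1977, II.6 (curves and function fields, Cor. 6.12)] -/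
instance isAlgFunctionField_of_smoothCurve : IsAlgFunctionField K C.left.functionField :=
  haveI : Smooth C.hom := SmoothOfRelativeDimension.smooth 1 C.hom
  isAlgFunctionField C (height_top_of_smoothCurve C)

/-- `K` is the full constant field of `K(C)` for a smooth proper geometrically integral curve. [cite: GortzWedhorn2023, Cor. 24.63 (p. 539)] -/
instance isIntegrallyClosedIn_of_smoothCurve [GeometricallyIntegral C.hom] :
    IsIntegrallyClosedIn K C.left.functionField :=
  isIntegrallyClosedIn C

/-- The **genus of the smooth complete curve `C / K`**: the genus `g = max (deg D − ℓ(D) + 1)` of its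
function field `K(C)/K` (Stichtenoth Def. 1.4.15; for `K` the full constant field this is
`dim H¹(C, 𝒪_C)`, Hartshorne IV.1). [cite: Stichtenoth2009, Def. 1.4.15] -/
def curveGenus : ℕ := genus K C.left.functionField

/-- **Riemann's inequality for Cartier divisors on a smooth complete curve**:
`h⁰(C, 𝒪(D)) ≥ deg D + 1 − g` (Hartshorne IV.1 Thm. 1.3 with `ℓ(K − D) ≥ 0`; Stichtenoth
Thm. 1.4.17 (a)). [cite: Hartshorne1977, IV.1 Thm. 1.3 (Riemann–Roch)] -/
theorem degree_add_one_sub_genus_le_h0 (D : CartierDivisor C.left) :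
    CartierDivisor.degree C D + 1 - (curveGenus C : ℤ) ≤ (D.h0 K : ℤ) := by
  have h := degree_add_one_sub_ell_le_genus_holds (K := K) (F := C.left.functionField) (toDivisor C D)
  rw [degree_toDivisor, ← h0_eq_ell] at h
  unfold curveGenus
  omega

/-- **Riemann–Roch for divisors of large degree on a smooth complete geometrically integral
curve**: if `deg D > 2g − 2` then `h⁰(C, 𝒪(D)) = deg D + 1 − g` (Hartshorne IV.1 Thm. 1.3 with
Example 1.3.4; Stichtenoth Thm. 1.5.17). [cite: Hartshorne1977, IV.1 Thm. 1.3 and Ex. 1.3.4] -/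
theorem h0_eq_of_lt_degree [GeometricallyIntegral C.hom]
    (D : CartierDivisor C.left) (hD : 2 * (curveGenus C : ℤ) - 2 < CartierDivisor.degree C D) :
    (D.h0 K : ℤ) = CartierDivisor.degree C D + 1 - curveGenus C := by
  unfold curveGenus at hD ⊢
  have h := ell_eq_of_lt_degree_holds (K := K) (F := C.left.functionField)
    (show 2 * (genus K C.left.functionField : ℤ) - 2 < (toDivisor C D).degree by
      rwa [degree_toDivisor])
  rw [degree_toDivisor, ← h0_eq_ell] at h
  exact h

/-- **Riemann–Roch with a canonical divisor of the function field**: there is a canonical divisor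
`W` of `K(C)/K` (`deg W = 2g − 2`, `ℓ(W) = g`) with `h⁰(C, 𝒪(D)) = deg D + 1 − g + ℓ(W − toDivisor D)`
for every Cartier divisor `D` (Hartshorne IV.1 Thm. 1.3; Stichtenoth Thm. 1.5.15). [cite: Hartshorne1977, IV.1 Thm. 1.3 (Riemann–Roch)] -/
theorem riemannRoch [GeometricallyIntegral C.hom] :
    ∃ W : Divisor K C.left.functionField, W.IsCanonical ∧
      ∀ D : CartierDivisor C.left, (D.h0 K : ℤ) =
        CartierDivisor.degree C D + 1 - curveGenus C + ell (W - toDivisor C D) := by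
  obtain ⟨W, hW, h⟩ := riemann_roch_holds (K := K) (F := C.left.functionField)
  refine ⟨W, hW, fun D ↦ ?_⟩
  have hD := h (toDivisor C D)
  rw [degree_toDivisor, ← h0_eq_ell] at hD
  exact hD

/-- **`h⁰(C, 𝒪_C) = 1`** on a smooth complete geometrically integral curve (`ℓ(0) = 1`,
Stichtenoth Cor. 1.4.12 (a); `Γ(C, 𝒪_C) = K`). [cite: Stichtenoth2009, Cor. 1.4.12] -/
theorem h0_zero [GeometricallyIntegral C.hom] : (0 : CartierDivisor C.left).h0 K = 1 := by
  rw [h0_eq_ell]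
  have h0 : toDivisor C (0 : CartierDivisor C.left) = 0 := by
    ext v; simp [CartierDivisor.ordAt_zero]
  rw [h0]
  exact ell_zero_holds

end RiemannRoch

end CurvePlaces

end Literature.AlgebraicGeometry.Motives
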